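import Literature.AlgebraicGeometry.Resolution.ResolutionFibreDimension
import Literature.AlgebraicGeometry.Resolution.NonPrincipalLocus
import Mathlib.AlgebraicGeometry.FunctionField
import HarnessLib

/-!
# The integral exceptional curves of a resolution of a surface singularity, as points

Topic: `Literature/AlgebraicGeometry/Resolution`. PROVED glue between the two indexings of the
exceptional curves of a resolution `π : X → Spec T` of a two-dimensional Noetherian local domain
`T` used in this tree:

* `excCurvePoints π` (`Resolution/Lipman1969RationalSurfaceSingularities`, Lipman 1969 §12: the
  generic points `η` of the *integral exceptional curves*, i.e. `π η = 𝔪` and `height η = 1` —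
  the index set of the numerical criterion `Lipman1969_12_1_i/_ii`), and
* `excPoints π` (`Resolution/ReflexiveModulesRationalDoublePoints`, Artin–Verdier 1985: the maximal
  points of the closed fibre, "`C = ∪ C_i`"), together with the codimension-one condition
  `coheight η = 1` under which Mathlib's order of vanishing `Scheme.ord _ η` is meaningful.

For `π` a resolution (`IsResolution`) and `ringKrullDim T = 2`:
`height η + coheight η ≤ 2` for every point (`dim X ≤ 2`); a point of the closed fibre has
`height ≤ 1` and is not the generic point; **`excCurvePoints π ⊆ excPoints π`**;
**`η ∈ excCurvePoints π ↔ η ∈ excPoints π ∧ {η}` not closed**; and every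
`η ∈ excCurvePoints π` has **`coheight η = 1`** (it is a codimension-one point of `X`).

## References

* J. Lipman, *Rational singularities …*, Publ. Math. IHÉS 36 (1969), §10 (p. 212: "the components
  of `C` are in one-one correspondence with the (finitely many) non-closed points of `C`"), §12
  (p. 220). [Lipman1969]
* M. Artin, J.-L. Verdier, Math. Ann. 270 (1985), p. 79 ("`C = ∪ C_i` the closed fibre").
  [ArtinVerdier1985]
-/

noncomputable section

open CategoryTheory AlgebraicGeometry TopologicalSpace Topology IsLocalRing

universe u

namespace Literature.AlgebraicGeometry.Resolution

/-- In `ℕ∞`: `a + b ≤ 2` and `0 < b` give `a ≤ 1`. [folklore] -/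
private theorem enat_le_one_of_add_le_two {a b : ℕ∞} (h : a + b ≤ 2) (hb : 0 < b) : a ≤ 1 := by
  induction a using ENat.recTopCoe with
  | top => simp at h
  | coe a =>
    induction b using ENat.recTopCoe with
    | top => simp at h
    | coe b =>
      have h' : a + b ≤ 2 := by exact_mod_cast h
      have hb' : 0 < b := by exact_mod_cast hb
      exact_mod_cast (show a ≤ 1 by omega)

/-- In the specialisation preorder of a scheme (`x ≤ y ↔ y ⤳ x`), a proper specialisation is
strictly smaller (schemes are `T₀`). [folklore] -/
private theorem lt_of_specializes_of_ne {X : Scheme.{u}} {x y : X} (h : y ⤳ x) (hne : x ≠ y) :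
    x < y :=
  ⟨Scheme.le_iff_specializes.2 h, fun h' => hne ((Scheme.le_iff_specializes.1 h').antisymm h).eq⟩

section Resolution

variable {T : Type u} [CommRing T] [IsNoetherianRing T] [IsDomain T] [IsLocalRing T]
  {X : Scheme.{u}} {π : X ⟶ Spec (.of T)}

omit [IsDomain T] [IsLocalRing T] in
/-- For a resolution `π : X → Spec T` of a Noetherian domain of Krull dimension `≤ 2`, every point
`x ∈ X` has `height x + coheight x ≤ 2` (`dim X ≤ dim T ≤ 2`,
`IsResolution.topologicalKrullDim_le_of_isNoetherian`). [cite: EGAIV2, 5.6.5.1] -/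
theorem IsResolution.height_add_coheight_le_two (hdim : ringKrullDim T ≤ 2)
    (hπ : IsResolution π) (x : X) : Order.height x + Order.coheight x ≤ 2 := by
  haveI : IsProper π := hπ.isProper
  haveI : IsNoetherian X := by
    haveI : IsLocallyNoetherian X := LocallyOfFiniteType.isLocallyNoetherian π
    haveI : CompactSpace X := QuasiCompact.compactSpace_of_compactSpace π
    exact {}
  have hX : topologicalKrullDim X ≤ 2 := by
    refine hπ.topologicalKrullDim_le_of_isNoetherian.trans ?_
    change topologicalKrullDim (PrimeSpectrum T) ≤ 2
    rw [PrimeSpectrum.topologicalKrullDim_eq_ringKrullDim]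
    exact hdim
  have := (coe_height_add_coheight_le_topologicalKrullDim x).trans hX
  rwa [← WithBot.coe_ofNat, WithBot.coe_le_coe] at this

omit [IsNoetherianRing T] in
/-- For a resolution `π : X → Spec T` of a Noetherian local domain of Krull dimension `2`, a point
of the closed fibre is not the generic point of `X` (the generic point maps to the zero ideal,
which is not maximal since `dim T ≠ 0`). [folklore] -/
private theorem IsResolution.ne_genericPoint_of_base_eq_closedPoint [IsIntegral X]
    (h2 : ringKrullDim T = 2) (hπ : IsResolution π) {η : X} (hη : π η = closedPoint T) :
    η ≠ genericPoint X := by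
  haveI : IsDominant π := hπ.isBirational.isDominant
  intro h
  subst h
  have hξ : π (genericPoint X) = genericPoint (Spec (.of T)) :=
    Motives.RatFn.genericPoint_eq_of_isDominant π
  rw [hξ, genericPoint_eq_bot_of_affine] at hη
  have hm : maximalIdeal T = ⊥ := by
    have := congrArg PrimeSpectrum.asIdeal hη
    change (closedPoint T).asIdeal = ⊥
    simpa using this.symm
  have h0 := IsLocalRing.maximalIdeal_height_eq_ringKrullDim (R := T)
  rw [hm, Ideal.height_bot, h2] at h0
  exact absurd h0 (by decide)

/-- **Points of the closed fibre have height `≤ 1`**: for a resolution `π : X → Spec T` of a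
Noetherian local domain of Krull dimension `2`, every `η` over the closed point has a closure of
dimension `≤ 1` (`height η ≤ 1`: `height η + coheight η ≤ 2` and `η` is not the generic point).
[cite: Lipman1969, Section 12 (hypothesis "fibres of dimension ≤ 1")] -/
theorem IsResolution.height_le_one_of_base_eq_closedPoint (h2 : ringKrullDim T = 2)
    (hπ : IsResolution π) {η : X} (hη : π η = closedPoint T) : Order.height η ≤ 1 := by
  haveI : IsIntegral X := hπ.isIntegral_source
  have hne := hπ.ne_genericPoint_of_base_eq_closedPoint h2 hη
  have hlt : η < genericPoint X := lt_of_specializes_of_ne (genericPoint_specializes η) hne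
  exact enat_le_one_of_add_le_two (hπ.height_add_coheight_le_two h2.le η)
    (Order.coheight_pos.mpr fun hmax => hlt.not_ge (hmax hlt.le))

/-- **Integral exceptional curves are components of the closed fibre**: for a resolution
`π : X → Spec T` of a Noetherian local domain of Krull dimension `2`,
`excCurvePoints π ⊆ excPoints π` (a point of the closed fibre properly generising `η` would have
height `≥ 2`). [cite: Lipman1969, Section 10 (p. 212) and Section 12 (p. 220)] -/
theorem IsResolution.excCurvePoints_subset_excPoints (h2 : ringKrullDim T = 2)
    (hπ : IsResolution π) : excCurvePoints π ⊆ excPoints π := by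
  intro η hη
  obtain ⟨hη𝔪, hh⟩ := hη
  refine (mem_excPoints_iff π η).2 ⟨hη𝔪, fun η' hη' hsp => ?_⟩
  by_contra hne
  have hlt : η < η' := lt_of_specializes_of_ne hsp (Ne.symm hne)
  have h1 := Order.height_add_one_le hlt
  rw [hh] at h1
  have h2' := hπ.height_le_one_of_base_eq_closedPoint h2 hη'
  have : (1 : ℕ∞) + 1 ≤ 1 := h1.trans h2'
  exact absurd this (by decide)

/-- **The integral exceptional curves are exactly the non-closed maximal points of the closed
fibre** (resolution of a Noetherian local domain of Krull dimension `2`): `η ∈ excCurvePoints π`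
iff `η ∈ excPoints π` and `{η}` is not closed (Lipman 1969, §10: components of a curve ↔ its
non-closed points). [cite: Lipman1969, Section 10 (p. 212)] -/
theorem IsResolution.mem_excCurvePoints_iff (h2 : ringKrullDim T = 2) (hπ : IsResolution π)
    {η : X} : η ∈ excCurvePoints π ↔ η ∈ excPoints π ∧ ¬ IsClosed ({η} : Set X) := by
  constructor
  · intro hη
    refine ⟨hπ.excCurvePoints_subset_excPoints h2 hη, fun hcl => ?_⟩
    have h0 := Scheme.height_of_isClosed hcl
    rw [hη.2] at h0
    exact one_ne_zero h0
  · rintro ⟨hηexc, hncl⟩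
    have hη𝔪 := base_eq_closedPoint_of_mem_excPoints hηexc
    refine ⟨hη𝔪, le_antisymm (hπ.height_le_one_of_base_eq_closedPoint h2 hη𝔪) ?_⟩
    -- a proper specialisation of `η` exists since `{η}` is not closed
    have hne : closure ({η} : Set X) ≠ {η} := fun h => hncl (h ▸ isClosed_closure)
    have hss : ({η} : Set X) ⊂ closure {η} := Set.ssubset_iff_subset_ne.2 ⟨subset_closure, hne.symm⟩
    obtain ⟨x, hx, hxs⟩ := Set.exists_of_ssubset hss
    have hxη : x ≠ η := fun h => hxs (Set.mem_singleton_iff.2 h)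
    have hsp : η ⤳ x := specializes_iff_mem_closure.2 hx
    have hlt : x < η := lt_of_specializes_of_ne hsp hxη
    have h1 := Order.height_add_one_le hlt
    exact le_trans (by simp) h1

/-- **Integral exceptional curves are codimension-one points**: for a resolution
`π : X → Spec T` of a Noetherian local domain of Krull dimension `2`, every `η ∈ excCurvePoints π`
has `coheight η = 1` — so Mathlib's order of vanishing `Scheme.ord _ η` along `E_η` is the genuine
valuation `ord_{E_η}` (it is `0` by convention off codimension one). [folklore: `height + coheight
≤ dim X = 2`, `height η = 1`, `η ≠` generic point] [cite: Lipman1969, Section 12 (p. 220)] -/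
theorem IsResolution.coheight_eq_one_of_mem_excCurvePoints (h2 : ringKrullDim T = 2)
    (hπ : IsResolution π) {η : X} (hη : η ∈ excCurvePoints π) : Order.coheight η = 1 := by
  haveI : IsIntegral X := hπ.isIntegral_source
  have hne := hπ.ne_genericPoint_of_base_eq_closedPoint h2 hη.1
  have hlt : η < genericPoint X := lt_of_specializes_of_ne (genericPoint_specializes η) hne
  have hpos : 0 < Order.coheight η :=
    Order.coheight_pos.mpr fun hmax => hlt.not_ge (hmax hlt.le)
  have hsum := hπ.height_add_coheight_le_two h2.le η
  rw [hη.2, add_comm] at hsum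
  refine le_antisymm (enat_le_one_of_add_le_two hsum (by decide)) ?_
  exact Order.one_le_iff_pos.mpr hpos

end Resolution

end Literature.AlgebraicGeometry.Resolution

end
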